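import Summits.QuantumFields.YangMills.Theorems.BalabanUVNodesK0AxJoinTD9
import Summits.QuantumFields.YangMills.Theorems.BalabanUVNodesK0AxJoinTGeomB

/-!
# NODE O · K0ᴬ — §4 v1.1 of the (R-a) file: ★★★ `twoVolExp_LocUniv_of_cmp` RE-SIGNED per ◆ CRIT-1 g36 (Q-ord) and ★★★ №543 (1) := (f2) —
# [E] from (Tok-cmpU-cap) + ⁸'s mould + the chart rows, with the D9 row (★★★ PTB-1), the LEAVES and the GEOMETRY (G0)–(G4) DISCHARGED INSIDE

LANDING NOTE (porter ▶ PTC-1 g4, 2026-08-31; AUTHORSHIP = ◇ lens-1 g10 «cauchy-analytic», HOME sketch `nodeO-cover/LENS-1g10-Ra-v1p1-Cmp.lean` sha16 87c4606e9546a4b8 · 101 l. · 1 thm · 0 sorry):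
landed VERBATIM (only this paragraph added) as the SECOND file of ★★★ director-ym №543 (1) — «§4 `twoVolExp_LocUniv_of_cmp` ONLY after ◇ lens-1 g10 posts v1.1 with (f2) and ◆ stamps the
new §4 signature (one line) → second file `…K0AxJoinTD9Cmp.lean`»; v1.1 posted 09:32:43Z (nodeO STATUS); ◆ CRIT-1 g36's one-line (Q-ord) stamp on this signature: «(Q-ord) PASS, SIGNATURE PASS, GO to land … VERBATIM» (nodeO STATUS 2026-08-31T09:38:02Z, l.5035; J1′∕J5′∕Federbush ✓, axioms standard on ◆'s own farm run); helper
`--supports stmt-QuantumFields-27238 --as helper` (NO `--workitem`).  Companion of ✓p818279 `…K0AxJoinTD9.lean` (PART A §1–§3 + `TokCmpUCap`).  HONEST (porter): a CONDITIONAL theorem over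
DISPLAYED rows (D1 = ⟨27930⟩'s ⁸ consequent OPEN; swap ∕ C² ∕ zero ∕ link rows of ONE chart = PART B, OPEN; (Tok-cmpU-cap) OPEN Bałaban content); [E] inhabited unconditionally NOWHERE;
K0ᴬ stmt-QuantumFields-27238 OPEN — NOTHING of it proved; nothing of Bałaban asserted, ported, discharged or refuted; NODE O 0∕1; COUNT 8∕28 · K 1∕4 UNMOVED; finite 𝕋⁴ at fixed ε —
NOT continuum ∕ OS ∕ Clay; the Yang–Mills mass gap is NOT proved by any of this.

◇ `ymgap-nodeO-lens-1` g10 (planner; typed for the porter ▶ PTC-1 g4, target `Summits/QuantumFields/YangMills/Theorems/BalabanUVNodesK0AxJoinTD9Cmp.lean`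
`--supports stmt-QuantumFields-27238 --as helper`).  Items: K0ᴬ `Record13SepCoPHInhabitedAx` (stmt-QuantumFields-27238) OPEN; K0⁷ 20541 OPEN.

(Q-ord) (◆ CRIT-1 g36 2026-08-31T09:19:31Z; ★★★ №543 (1)).  v1's §4 bound the leaf constants `K₀' K₁` (universal) OUTSIDE the produced `∃ δ₀` while the cube-sum leaf is
read at `δ₀∕4` — shape `∀ K₁, ∃ δ₀, (Leaf δ₀ K₁ → [E])`, not applicable (`K₁ = K₁(δ₀)`).  FIX (f2): NO consumer constant is bound before the existential it depends on — the
leaves are DISCHARGED inside from the catalogue guard `McGuard F Mc` by ✓`PortHRecordRowG.rowCubeSumLeaf_at'` (cube-sum leaf at `δ₀∕4`, constant `(2(1 − e^{−δ₀∕4})⁻¹)⁴`)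
and ✓`PortHRecordRowG.rowW_treeLeaves_at` (tree leaf at `κ∕4 = κ∕2∕2`, constant `B12TreeDecay.K₀ 64 8`, for `κ ≥ 4κ₀(64, 8)`); the five geometry rows (G0)–(G4) are
discharged at the record choice `Nin := recordRNat`, `Rsep := recordR∕2 − 2Mc`, `cR := 1∕16` by ✓`K0AxJoinTGeomA.rowG0 ∕ rowG3a ∕ rowG3b ∕ rowG4 ∕ cR_record` and
✓`K0AxJoinTGeomB.rowG1_at_recordChoice ∕ rowG2_at_recordChoice` (guards `Mc ≤ Mg`, `0 ≤ c₁`), exactly as ✓`kstep_joinT_at_record_geomAB` did; the D9 row `∀ a,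
Response9DAtLocUnivξ …` is supplied by ★★★ PTB-1's ✓`PortU8.portPieceLocalityU8_LocUniv_of_cmp` at `α₂ := min ¼ (min α₁ (α₀∕36))` from (Tok-cmpU-cap) `TokCmpUCap F Mc a₀`.
RESULTING SHAPE: `… → ∃ C₉ δ₀, 0 ≤ C₉ ∧ 0 < δ₀ ∧ ∀ ιC, D1 → swap → (C² ∕ zero ∕ link rows of ιC against recordGkLocWξ univ) → RecordPvolTwoVolExpOnRunsAx F a₀ ε₂₉ γ₀ (E(E₀,C₉,δ₀,κ,Mg,c₁)) (δ₁∕16)`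
with the [E]-constant an EXPLICIT function of the ∃-bound `C₉ δ₀` and the outer `E₀ κ Mg c₁` — ◆'s `P := False` toy no longer applies (every consumer is inside).

WHAT STAYS DISPLAYED: D1 (⁸'s `FormatPlusG` mould at `recordEmbJ` on `]0, γ₀]`-runs = ⟨27930⟩ OPEN), the swap row of the ONE chart `ιC` vs `recordEmbJ` (orbit statement), and
the `C²`∕zero∕link rows of `ιC` against the TRANSVERSE TABLE `recordGkLocWξ … univ` — jointly the (R-a) rows of the leg-dressed chart `recordEmbJDressed` (DEF-1 ed.20) GIVEN
`DressLink` ⟸ (C-orb) `RootedResponseOrbitAt` mod P0 (PART B; OPEN).  HONEST: a CONDITIONAL theorem; [E] inhabited unconditionally NOWHERE; nothing of Bałaban ([I] Thm 1,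
(1.18)–(1.22), (4.35)–(4.37); [15] Prop. 9; [B6] (2.35)) asserted, ported or discharged; K0ᴬ 27238 OPEN; NODE O 0∕1; COUNT 8∕28 · K 1∕4 UNMOVED; finite `𝕋⁴_{L^K}` at fixed ε —
NOT continuum ∕ OS ∕ Clay; **the Yang–Mills mass gap is NOT proved.**  No `instance ∕ notation ∕ allowUnsafeReducibility`; 0 sorry; standard axioms.
-/

noncomputable section

open Filter Topology
open scoped BigOperators Matrix.Norms.L2Operator

namespace Summit.QuantumFields.YangMills.Theorems.K0AxJoinT

open Literature.MathematicalPhysics.QuantumFieldTheory.Balaban1983to89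
open Literature.MathematicalPhysics.QuantumFieldTheory.Balaban1983to89.Node00 (betaOfRecord₁₃Ax Stage13Params)
open Literature.MathematicalPhysics.QuantumFieldTheory.Balaban1983to89.T4Continuum (T4Family)
open Literature.MathematicalPhysics.QuantumFieldTheory.Balaban1983to89.B12FormatPlus
open Summit.QuantumFields.YangMills.Theorems.K0RecordFormatNames
open Summit.QuantumFields.YangMills.Theorems.K0AxTwoVolumeRate (RecordPvolTwoVolExpOnRunsAx)
open Summit.QuantumFields.YangMills.Theorems.K0AxJoinTGeomA (rowG0 rowG3a rowG3b rowG4 cR_record)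
open Summit.QuantumFields.YangMills.Theorems.K0AxJoinTGeomB (rowG1_at_recordChoice rowG2_at_recordChoice)
open Summit.QuantumFields.YangMills.Theorems.PortHRecordRowG (rowCubeSumLeaf_at' rowW_treeLeaves_at)
open Summit.QuantumFields.YangMills.Theorems.PortHRecordJoin (kappa₀_std_pos)
open Literature.MathematicalPhysics.QuantumFieldTheory.Balaban1983to89.FlowStep
open Literature.MathematicalPhysics.QuantumFieldTheory.Balaban1983to89.FlowStepRuns

/-- ★★★ **`twoVolExp_LocUniv_of_cmp` (v1.1, (Q-ord)-clean) — [E] FROM (Tok-cmpU-cap) + ⁸'s MOULD + THE THREE CHART ROWS; D9, LEAVES AND GEOMETRY DISCHARGED.**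
For `0 ≤ E₀`, `κ ≥ 4κ₀(64, 8)`, `0 < Mg`, `0 ≤ c₁`; every `F a₀ ε₂₉ γ₀ α₀ α₁` with `0 < ε₂₉`, `0 < α₀`, `0 < α₁`; every admissible letter `McGuard F Mc` with `Mc ≤ Mg` and
(Tok-cmpU-cap) `TokCmpUCap F Mc a₀`: THERE ARE `C₉ ≥ 0`, `δ₀ > 0` (★★★ PTB-1's package at `α₂ := min ¼ (min α₁ (α₀∕36))`) such that for EVERY chart family `ιC`, D1 + the swap
row + the `C²`∕zero∕link rows of `ιC` against `recordGkLocWξ … univ` give [E] `RecordPvolTwoVolExpOnRunsAx F a₀ ε₂₉ γ₀ E (δ₁∕16)` with `δ₁ = delta1 δ₀ κ Mg`,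
`E = 48E₀C₉²K₀K₁ + 32E₀C₉²e^{δ₁Mg c₁}K₀K₁`, `K₀ = B12TreeDecay.K₀ 64 8`, `K₁ = (2(1 − e^{−δ₀∕4})⁻¹)⁴` — all inside the ∃.  CONDITIONAL; nothing of Bałaban asserted; K0ᴬ OPEN;
the Yang–Mills mass gap is NOT proved.
[cite: Balaban1987RG1, Thm 1 p.259, (0.20) p.256, (1.7) p.261, (1.18)–(1.22) pp.263–264, (4.4)–(4.5) pp.281–282, (4.35)–(4.37) pp.290–291, (5.10) p.293; Balaban1985Variational, Prop. 9 p.309, (190) p.308; Balaban1984PropagatorsII, (2.35) p.228, (2.130) p.246] -/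
theorem twoVolExp_LocUniv_of_cmp {E₀ κ Mg c₁ : ℝ}
    (hE₀ : 0 ≤ E₀) (hκ : 4 * B12TreeDecay.kappa₀ (4 * 2 ^ 4) (2 * 4) ≤ κ) (hMg : 0 < Mg) (hc₁ : 0 ≤ c₁) :
    ∀ (F : T4Family) (a₀ ε₂₉ γ₀ α₀ α₁ : ℝ), 0 < ε₂₉ → 0 < α₀ → 0 < α₁ → ∀ Mc : ℕ, McGuard F Mc → (Mc : ℝ) ≤ Mg → TokCmpUCap F Mc a₀ →
      ∃ C₉ δ₀ : ℝ, 0 ≤ C₉ ∧ 0 < δ₀ ∧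
      letI θ := thetaFill F a₀ ε₂₉; letI := θ.instVβ₁; letI := θ.instVβ₂; letI := θ.instιβ
      ∀ (ιC : (k n : ℕ) → recordW F a₀ ε₂₉ k (recordK₀ F Mc k + n) → (Fin (recordChartDimJ F (recordK₀ F Mc k + n)) → ℂ)),
      (∀ (k : ℕ) (g : ℕ → ℝ), FlowStep.RGEqH k (betaOfRecord₁₃Ax F 2 (thetaFill F a₀ ε₂₉)) g → Step.InInterval γ₀ k g →
        B12FormatPlus.FormatPlusG (fun n => recordDomSys F Mc k (recordK₀ F Mc k + n)) (fun n => recordBondCount F (recordK₀ F Mc k + n))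
          (fun n => recordAct F (recordK₀ F Mc k + n)) (fun n => recordUc F Mc k α₀ α₁ (recordK₀ F Mc k + n))
          (fun n => recordCoords F Mc k (recordK₀ F Mc k + n)) (fun n => recordChartDimJ F (recordK₀ F Mc k + n))
          (fun n => recordChartJ F Mc k (recordK₀ F Mc k + n)) (fun n => recordΦfAx F a₀ ε₂₉ k (FlowStep.prefixOf g k) (recordK₀ F Mc k + n))
          (fun n => recordEmbJ F θ k (recordK₀ F Mc k + n)) (fun n => recordWrapCtr F Mc k (recordK₀ F Mc k + n))
          (fun n => recordDomEmbCtr F Mc k (recordK₀ F Mc k + n)) (fun n _ => recordCoordProjCtr F (recordK₀ F Mc k + n)) E₀ κ) →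
      (∀ (k n : ℕ), ∀ᶠ B in 𝓝 (0 : recordW F a₀ ε₂₉ k (recordK₀ F Mc k + n)), ∀ X : (recordDomSys F Mc k (recordK₀ F Mc k + n)).Dom,
          ∃ g : recordGaugeGrp F (recordK₀ F Mc k + n), ∀ i ∈ recordCoords F Mc k (recordK₀ F Mc k + n) X,
            recordChartJ F Mc k (recordK₀ F Mc k + n) X (ιC k n B) i =
              recordAct F (recordK₀ F Mc k + n) g (recordChartJ F Mc k (recordK₀ F Mc k + n) X (recordEmbJ F θ k (recordK₀ F Mc k + n) B)) i) →
      (∀ k : ℕ, (∀ n : ℕ, ContDiffAt ℝ 2 (ιC k n) 0 ∧ ιC k n 0 = 0) ∧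
          ∀ (n : ℕ) (a : θ.ιβ) (l : RespLabel F k (recordK₀ F Mc k + n)),
            recordGkLocWξ F θ k (recordK₀ F Mc k + n) Finset.univ a l = fun i => fderiv ℝ (ιC k n) 0 (Pi.single l.1 (Pi.single l.2 (θ.bV a))) i) →
      RecordPvolTwoVolExpOnRunsAx F a₀ ε₂₉ γ₀
        (48 * E₀ * C₉ ^ 2 * B12TreeDecay.K₀ (4 * 2 ^ 4) (2 * 4) * (2 * (1 - Real.exp (-(δ₀ / 4)))⁻¹) ^ 4 +
          32 * E₀ * C₉ ^ 2 * Real.exp (B12Decay510.delta1 δ₀ κ Mg * Mg * c₁) * B12TreeDecay.K₀ (4 * 2 ^ 4) (2 * 4) * (2 * (1 - Real.exp (-(δ₀ / 4)))⁻¹) ^ 4)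
        (B12Decay510.delta1 δ₀ κ Mg * (1 / 16)) := by
  intro F a₀ ε₂₉ γ₀ α₀ α₁ hε hα₀ hα₁ Mc hMc hMgMc hcmp
  have hα₂ : 0 < min (1 / 4 : ℝ) (min α₁ (α₀ / 36)) := lt_min (by norm_num) (lt_min hα₁ (by positivity))
  obtain ⟨C₉, δ₀, hC₉, hδ₀, hpk⟩ := PortU8.portPieceLocalityU8_LocUniv_of_cmp F Mc a₀ hMc hcmp (min (1 / 4 : ℝ) (min α₁ (α₀ / 36))) hα₂
  refine ⟨C₉, δ₀, hC₉, hδ₀, fun ιC h8 hsw h9 => ?_⟩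
  have hκ0 : 0 < κ := by linarith [kappa₀_std_pos]
  have hK₀ : 0 ≤ B12TreeDecay.K₀ (4 * 2 ^ 4) (2 * 4) := (B12TreeDecay.K₀_pos _ _).le
  have hδ4 : 0 < δ₀ / 4 := by positivity
  -- the leaves at `δ₀∕4` (cube sums) and `κ∕4` (trees), from the catalogue guard
  have hleaf : ∀ k n : ℕ, B12Decay510.CubeSumLeaf (recordSiteGeom F Mc k (recordK₀ F Mc k + n)) (δ₀ / 4) ((2 * (1 - Real.exp (-(δ₀ / 4)))⁻¹) ^ 4) ∧
      B12Decay510.TreeLeaf (recordCc F Mc k (recordK₀ F Mc k + n)) (κ / 4) (B12TreeDecay.K₀ (4 * 2 ^ 4) (2 * 4)) := by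
    intro k n
    refine ⟨rowCubeSumLeaf_at' hMc k _ hδ4, ?_⟩
    rw [show κ / 4 = κ / 2 / 2 by ring]
    exact (rowW_treeLeaves_at hMc hκ n).2.2
  exact kstep_joinT_at_record_LocUniv (K₀' := B12TreeDecay.K₀ (4 * 2 ^ 4) (2 * 4)) (K₁ := (2 * (1 - Real.exp (-(δ₀ / 4)))⁻¹) ^ 4)
    hE₀ hκ0 hC₉ hδ₀ hMg hK₀ F a₀ ε₂₉ γ₀ α₀ α₁ hα₀ hα₁ Mc
    (fun k n => recordRNat F Mc k (recordK₀ F Mc k + n)) (fun k n => recordR F Mc k (recordK₀ F Mc k + n) / 2 - 2 * (Mc : ℝ)) (1 / 16)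
    cR_record.1 cR_record.2 ιC h8 hsw (fun k => ⟨fun a => (hpk k ε₂₉ hε).1 a, (h9 k).1, (h9 k).2⟩)
    (rowG0 F Mc) (rowG1_at_recordChoice F hMc hMgMc hc₁) (rowG2_at_recordChoice F hMc hMgMc hc₁) (rowG3a F Mc) (rowG3b hMc) (rowG4 hMc) hleaf

end Summit.QuantumFields.YangMills.Theorems.K0AxJoinT

end
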